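import Summits.Ventures.Crystal3D.Theorems.StickyWulffConstantGenericWallFloorRefusalWalk
import Summits.Ventures.Crystal3D.Theorems.StickyWulffConstantGenericWallFloorCredits
import HarnessLib

/-!
# Every tilted tube pays, and the tubes are counted injectively (refusal walks, all non-co-axial pairs)

HONEST FRAMING. Venture `Summits/Ventures/Crystal3D` (cell `crystal3d-full`), helper for the crux
`GenericWallFloor` (stmt-Ventures-19480) of `route-Ventures-StickyWulffConstant`, REGISTERED line `WallLedgerG`,
open stub `stub_twoSlabAdhesion` (general fillings; the `Σ3ⁿ` chain pairs).  Rung credit only; F-C1 not moved.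

`refusal_tube_pays`: in the two-slab cell, for an admissible class `𝓐 ∋ A₁` with terminal family `± m` and a
tilted axis direction `z` (`⟪z, m⟫ = 0`, `⟪z, e₃⟫ ≥ σ > 0`, `e₃ = ⟪e₃,z⟫z + ⟪e₃,m⟫m`), every intended axis
through `(p₀, p₁, −R₀)` with `p₀² + p₁² ≤ (ρ − S₀ − 23)²`, `S₀ = (h + 3R₀ + 21)/σ`, carries an UNSATURATED ball
within lateral distance `21` of the intended line at height in `[−R₀ − 22, h + R₀ + 4)`: start ball of `P₁` under
the axis point (covering radius), three independent down slots, `refusal_walk_pays`.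
`card_refusalPayers_ge`: on the horizontal grid of spacing `43/σ` the intended lines are laterally `≥ 43` apart
(`‖v − ⟪v,z⟫z‖ ≥ ⟪z,e₃⟫‖v‖` for horizontal `v`), so payers of different axes differ:
`(2M+1)² ≤ #{x ∈ X : deg x ≠ 12, −R₀ − 22 ≤ x₂ ≤ h + R₀ + 4}` whenever `2 (43 M/σ)² ≤ (ρ − S₀ − 23)²`.
WHAT THIS IS NOT: not the stub; the ledger bookkeeping remains (next file); F-C1 not moved.
-/

noncomputable section

namespace Summit.Ventures.Crystal3D.Theorems

open Summit.Ventures.Crystal3D Finset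
open Literature.MathematicalPhysics.StatisticalMechanics (fccStacking)
open scoped InnerProductSpace

/-- The lateral projection is `1`-Lipschitz: `‖v − ⟪v,z⟫z‖ ≤ ‖v‖`. -/
theorem norm_lateral_le (v z : EuclideanSpace ℝ (Fin 3)) (hz : ‖z‖ = 1) : ‖v - ⟪v, z⟫_ℝ • z‖ ≤ ‖v‖ := by
  have h : ‖v - ⟪v, z⟫_ℝ • z‖ ^ 2 ≤ ‖v‖ ^ 2 := by
    rw [norm_sub_sq_real, norm_smul, hz, mul_one, real_inner_smul_right, Real.norm_eq_abs, sq_abs]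
    nlinarith [sq_nonneg ⟪v, z⟫_ℝ]
  exact (sq_le_sq₀ (norm_nonneg _) (norm_nonneg _)).1 h

/-- Lateral projection is additive. -/
theorem lateral_sub_lateral (u v z : EuclideanSpace ℝ (Fin 3)) :
    (u - ⟪u, z⟫_ℝ • z) - (v - ⟪v, z⟫_ℝ • z) = (u - v) - ⟪u - v, z⟫_ℝ • z := by
  rw [inner_sub_left, sub_smul]; abel

/-- **Horizontal vectors keep a fraction `⟪z, e₃⟫` of their length laterally.** -/
theorem lateral_sq_ge_of_horizontal (v z : EuclideanSpace ℝ (Fin 3)) (hz : ‖z‖ = 1) (hv : v 2 = 0) :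
    ⟪z, EuclideanSpace.single (2 : Fin 3) (1 : ℝ)⟫_ℝ ^ 2 * ‖v‖ ^ 2 ≤ ‖v - ⟪v, z⟫_ℝ • z‖ ^ 2 := by
  have hz2 : ⟪z, EuclideanSpace.single (2 : Fin 3) (1 : ℝ)⟫_ℝ = z 2 := by
    rw [EuclideanSpace.inner_single_right]; simp
  have hvn := norm_sq_eq_fin3 v
  have hzn := norm_sq_eq_fin3 z
  rw [hz, one_pow] at hzn
  have hvz : ⟪v, z⟫_ℝ = v 0 * z 0 + v 1 * z 1 := by
    have : ⟪v, z⟫_ℝ = ∑ i : Fin 3, v i * z i := by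
      rw [EuclideanSpace.inner_eq_star_dotProduct]; simp [dotProduct, Fin.sum_univ_three, mul_comm]
    rw [this, Fin.sum_univ_three, hv]; ring
  have hlat : ‖v - ⟪v, z⟫_ℝ • z‖ ^ 2 = ‖v‖ ^ 2 - ⟪v, z⟫_ℝ ^ 2 := by
    rw [norm_sub_sq_real, norm_smul, hz, mul_one, real_inner_smul_right, Real.norm_eq_abs, sq_abs]; ring
  rw [hlat, hz2, hvn, hv, hvz]
  nlinarith [sq_nonneg (v 0 * z 1 - v 1 * z 0), sq_nonneg (z 2), sq_nonneg (v 0), sq_nonneg (v 1)]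

open scoped Classical in
/-- **Every tilted tube pays.**  See the module docstring. -/
theorem refusal_tube_pays {δ : ℝ} (hg : KissingGap δ) (hc : KissingClassification δ)
    (X : Finset (EuclideanSpace ℝ (Fin 3))) (hX : ∀ p ∈ X, ∀ q ∈ X, p ≠ q → 1 ≤ dist p q)
    (A₁ : EuclideanSpace ℝ (Fin 3) ≃ₗᵢ[ℝ] EuclideanSpace ℝ (Fin 3)) (t₁ : EuclideanSpace ℝ (Fin 3))
    (A₂ : EuclideanSpace ℝ (Fin 3) ≃ₗᵢ[ℝ] EuclideanSpace ℝ (Fin 3)) (t₂ : EuclideanSpace ℝ (Fin 3))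
    (P₁ P₂ : Finset (EuclideanSpace ℝ (Fin 3))) (R₀ h ρ : ℝ) (hR₀ : 10 ≤ R₀) (hρ : R₀ ≤ ρ)
    (hh : 0 ≤ h) (hP₁X : P₁ ⊆ X) (hP₂X : P₂ ⊆ X) (hcell : ∀ p ∈ X, p 2 ≤ h + 2 * R₀)
    (hP₁ : ∀ p, p ∈ P₁ ↔ (p ∈ (fun q => A₁ q + t₁) '' fccStacking 1 (Real.sqrt (2 / 3)) ∧
      -(2 * R₀) ≤ p 2 ∧ p 2 ≤ -R₀ ∧ p 0 ^ 2 + p 1 ^ 2 ≤ ρ ^ 2))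
    (hP₂ : ∀ p, p ∈ P₂ ↔ (p ∈ (fun q => A₂ q + t₂) '' fccStacking 1 (Real.sqrt (2 / 3)) ∧
      h + R₀ ≤ p 2 ∧ p 2 ≤ h + 2 * R₀ ∧ p 0 ^ 2 + p 1 ^ 2 ≤ ρ ^ 2))
    (𝓣 : Set (EuclideanSpace ℝ (Fin 3) ≃ₗᵢ[ℝ] EuclideanSpace ℝ (Fin 3)))
    (hT : ∀ G : EuclideanSpace ℝ (Fin 3) ≃ₗᵢ[ℝ] EuclideanSpace ℝ (Fin 3),
      G '' fccStacking 1 (Real.sqrt (2 / 3)) = A₂ '' fccStacking 1 (Real.sqrt (2 / 3)) → G ∈ 𝓣)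
    (𝓐 : Set (EuclideanSpace ℝ (Fin 3) ≃ₗᵢ[ℝ] EuclideanSpace ℝ (Fin 3))) (hA₁ : A₁ ∈ 𝓐) (h𝓐 : ∀ F ∈ 𝓐, F ∉ 𝓣)
    {m : EuclideanSpace ℝ (Fin 3)} (hm : ‖m‖ = 1)
    (hmir : ∀ F ∈ 𝓐, ∀ n : EuclideanSpace ℝ (Fin 3), ‖n‖ = 1 →
      (∀ w ∈ fccSlots, ⟪F w, n⟫_ℝ = 0 ∨ ⟪F w, n⟫_ℝ = Real.sqrt (2 / 3) ∨ ⟪F w, n⟫_ℝ = -Real.sqrt (2 / 3)) →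
      ∀ F' : EuclideanSpace ℝ (Fin 3) ≃ₗᵢ[ℝ] EuclideanSpace ℝ (Fin 3), (∀ x, F' x = F x - (2 * ⟪F x, n⟫_ℝ) • n) →
        (F' ∉ 𝓣 → F' ∈ 𝓐) ∧ (F' ∈ 𝓣 → n = m ∨ n = -m))
    {z : EuclideanSpace ℝ (Fin 3)} (hz : ‖z‖ = 1) (hzm : ⟪z, m⟫_ℝ = 0)
    {σ : ℝ} (hσ : 0 < σ) (hσz : σ ≤ ⟪z, EuclideanSpace.single (2 : Fin 3) (1 : ℝ)⟫_ℝ)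
    (he₃ : EuclideanSpace.single (2 : Fin 3) (1 : ℝ) =
      ⟪EuclideanSpace.single (2 : Fin 3) (1 : ℝ), z⟫_ℝ • z + ⟪EuclideanSpace.single (2 : Fin 3) (1 : ℝ), m⟫_ℝ • m)
    (p0 p1 : ℝ) (hp : p0 ^ 2 + p1 ^ 2 ≤ (ρ - (h + 3 * R₀ + 21) / σ - 23) ^ 2)
    (hρS : (h + 3 * R₀ + 21) / σ + 23 ≤ ρ) :
    ∃ q ∈ X, (X.filter fun y' => dist q y' = 1).card ≠ 12 ∧
      ‖q - (EuclideanSpace.single (0 : Fin 3) p0 + EuclideanSpace.single (1 : Fin 3) p1 +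
          EuclideanSpace.single (2 : Fin 3) (-R₀)) -
        ⟪q - (EuclideanSpace.single (0 : Fin 3) p0 + EuclideanSpace.single (1 : Fin 3) p1 +
          EuclideanSpace.single (2 : Fin 3) (-R₀)), z⟫_ℝ • z‖ ≤ 21 ∧
      -R₀ - 22 ≤ q 2 ∧ q 2 < h + R₀ + 4 := by
  set Λ₁ : Set (EuclideanSpace ℝ (Fin 3)) := (fun q => A₁ q + t₁) '' fccStacking 1 (Real.sqrt (2 / 3)) with hΛ₁
  set e₃ : EuclideanSpace ℝ (Fin 3) := EuclideanSpace.single (2 : Fin 3) (1 : ℝ) with he₃def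
  set S₀ : ℝ := (h + 3 * R₀ + 21) / σ with hS₀
  have he₃n : ‖e₃‖ = 1 := by rw [he₃def, PiLp.norm_single, norm_one]
  have he₃i : ∀ d : EuclideanSpace ℝ (Fin 3), ⟪d, e₃⟫_ℝ = d 2 := fun d => by
    rw [he₃def, EuclideanSpace.inner_single_right]; simp
  have he₃0 : e₃ ≠ 0 := by
    intro h0; rw [h0, norm_zero] at he₃n; norm_num at he₃n
  have hS₀0 : 0 ≤ S₀ := by rw [hS₀]; apply div_nonneg <;> linarith
  have hρ0 : (0 : ℝ) ≤ ρ - S₀ - 23 := by linarith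
  -- the axis point at height `−R₀`
  set qpt : EuclideanSpace ℝ (Fin 3) := EuclideanSpace.single (0 : Fin 3) p0 + EuclideanSpace.single (1 : Fin 3) p1 +
    EuclideanSpace.single (2 : Fin 3) (-R₀) with hqpt
  have hq0 : qpt 0 = p0 := by simp [hqpt]
  have hq1 : qpt 1 = p1 := by simp [hqpt]
  have hq2 : qpt 2 = -R₀ := by simp [hqpt]
  -- a start ball of `Λ₁` within distance `< 1` of it and not higher
  obtain ⟨x₀, hx₀Λ, hdx, hx₀2⟩ : ∃ x₀ ∈ Λ₁, dist qpt x₀ < 1 ∧ x₀ 2 ≤ -R₀ := by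
    by_cases hq : qpt ∈ Λ₁
    · exact ⟨qpt, hq, by rw [dist_self]; norm_num, by rw [hq2]⟩
    · obtain ⟨v, hv, hd, hl⟩ := movedFcc_exists_near_below A₁ t₁ qpt hq
      exact ⟨v, hv, hd, by rw [hq2] at hl; exact hl⟩
  have hcoord : ∀ i : Fin 3, |x₀ i - qpt i| ≤ dist qpt x₀ := fun i => by
    rw [dist_comm]; exact abs_apply_sub_le_dist x₀ qpt i
  have hx₀2' : -R₀ - 1 < x₀ 2 := by
    have := (abs_le.1 (hcoord 2)).1; rw [hq2] at this; linarith
  have hS₀pos := hS₀0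
  have hR₀3 : (3 : ℝ) ≤ R₀ := by linarith only [hR₀]
  have hx₀h : (x₀ 0 - p0) ^ 2 + (x₀ 1 - p1) ^ 2 ≤ 1 ^ 2 := by
    have hn := norm_sq_eq_fin3 (x₀ - qpt)
    have hd1 : ‖x₀ - qpt‖ ^ 2 ≤ 1 := by
      rw [← dist_eq_norm, dist_comm]
      nlinarith only [hdx, dist_nonneg (x := qpt) (y := x₀)]
    simp only [PiLp.sub_apply, hq0, hq1] at hn
    linarith only [hn, hd1, sq_nonneg (x₀ 2 - qpt 2)]
  -- window membership of points of `Λ₁` near the axis point at the right heights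
  have inP₁ : ∀ v ∈ Λ₁, -(2 * R₀) ≤ v 2 → v 2 ≤ -R₀ → (v 0 - p0) ^ 2 + (v 1 - p1) ^ 2 ≤ 2 ^ 2 → v ∈ X := by
    intro v hv h1 h2 h3
    apply hP₁X
    rw [hP₁]
    refine ⟨hv, h1, h2, ?_⟩
    have := sq2_add_le hρ0 (by norm_num : (0 : ℝ) ≤ 2) hp h3
    have e0 : v 0 = p0 + (v 0 - p0) := by ring
    have e1 : v 1 = p1 + (v 1 - p1) := by ring
    have hsq : (ρ - S₀ - 23 + 2) ^ 2 ≤ ρ ^ 2 := by nlinarith only [hρ0, hS₀0]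
    rw [e0, e1]; linarith only [this, hsq]
  have hx₀X : x₀ ∈ X := inP₁ x₀ hx₀Λ (by linarith only [hx₀2', hR₀]) hx₀2 (by linarith only [hx₀h])
  -- three independent down slots, all window balls
  obtain ⟨sa, ha, sb, hb, sc, hc', ha', hb', hc'', hind⟩ := exists_independent_slots_of_hemisphere A₁ he₃0
  have down : ∀ {w}, w ∈ fccSlots → ⟪A₁ w, e₃⟫_ℝ < 0 → x₀ + A₁ w ∈ X := by
    intro w hw hneg
    rw [he₃i] at hneg
    have hw1 : ‖A₁ w‖ = 1 := by rw [LinearIsometryEquiv.norm_map, norm_eq_one_of_mem_fccSlots hw]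
    have hwn := norm_sq_eq_fin3 (A₁ w)
    rw [hw1, one_pow] at hwn
    have hw2 : -1 ≤ (A₁ w) 2 := by
      nlinarith only [hwn, sq_nonneg ((A₁ w) 0), sq_nonneg ((A₁ w) 1), sq_nonneg ((A₁ w) 2 + 1)]
    have hwh : (A₁ w) 0 ^ 2 + (A₁ w) 1 ^ 2 ≤ 1 ^ 2 := by linarith only [hwn, sq_nonneg ((A₁ w) 2)]
    apply inP₁ _ (movedFcc_add_site_mem A₁ t₁ hx₀Λ (mem_fcc_of_mem_fccSlots hw))
    · simp only [PiLp.add_apply]; linarith only [hx₀2', hw2, hR₀]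
    · simp only [PiLp.add_apply]; linarith only [hx₀2, hneg]
    · have := sq2_add_le (by norm_num : (0 : ℝ) ≤ 1) (by norm_num : (0 : ℝ) ≤ 1) hx₀h hwh
      simp only [PiLp.add_apply]
      have e0 : x₀ 0 + (A₁ w) 0 - p0 = (x₀ 0 - p0) + (A₁ w) 0 := by ring
      have e1 : x₀ 1 + (A₁ w) 1 - p1 = (x₀ 1 - p1) + (A₁ w) 1 := by ring
      rw [e0, e1]; linarith only [this]
  -- lateral control of the tube around the axis through `x₀`: deep-top balls stay inside the disc
  have hze₃pos : 0 < ⟪z, e₃⟫_ℝ := lt_of_lt_of_le hσ hσz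
  have hme₃ : |⟪m, e₃⟫_ℝ| ≤ 1 := by
    have := abs_real_inner_le_norm m e₃; rwa [hm, he₃n, one_mul] at this
  have hlat : ∀ y ∈ X, ‖y - x₀ - ⟪y - x₀, z⟫_ℝ • z‖ ≤ 20 → h + R₀ + 2 ≤ y 2 →
      y 0 ^ 2 + y 1 ^ 2 ≤ (ρ - 2) ^ 2 := by
    intro y hy hry hy2
    set s : ℝ := ⟪y - x₀, z⟫_ℝ with hs
    set r : EuclideanSpace ℝ (Fin 3) := y - x₀ - s • z with hr
    have hhy : y 2 = x₀ 2 + s * ⟪z, e₃⟫_ℝ + ⟪r, m⟫_ℝ * ⟪m, e₃⟫_ℝ := by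
      rw [real_inner_comm e₃ z, real_inner_comm e₃ m]
      exact height_eq_of_axis y x₀ z m hzm he₃
    have hrm : |⟪r, m⟫_ℝ * ⟪m, e₃⟫_ℝ| ≤ 20 * 1 := by
      rw [abs_mul]
      refine mul_le_mul ?_ hme₃ (abs_nonneg _) (by norm_num)
      have := abs_real_inner_le_norm r m; rw [hm, mul_one] at this; exact this.trans hry
    obtain ⟨hrm1, hrm2⟩ := abs_le.1 hrm
    -- `0 ≤ s ≤ S₀`
    have hsup : s * ⟪z, e₃⟫_ℝ ≤ h + 3 * R₀ + 21 := by
      linarith only [hcell y hy, hhy, hx₀2', hrm1]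
    have hslo : 0 ≤ s * ⟪z, e₃⟫_ℝ := by linarith only [hhy, hy2, hx₀2, hrm2, hh, hR₀]
    have hs0 : 0 ≤ s := nonneg_of_mul_nonneg_left hslo hze₃pos
    have hsS : s ≤ S₀ := by
      rw [hS₀, le_div_iff₀ hσ]
      have := mul_le_mul_of_nonneg_left hσz hs0
      linarith only [this, hsup]
    -- horizontal displacement from `x₀`
    have hdisp : (y 0 - x₀ 0) ^ 2 + (y 1 - x₀ 1) ^ 2 ≤ (S₀ + 20) ^ 2 := by
      have ey : ∀ i, y i - x₀ i = s * z i + r i := by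
        intro i; rw [hr]; simp only [PiLp.sub_apply, PiLp.smul_apply, smul_eq_mul]; ring
      have hzn := norm_sq_eq_fin3 z
      rw [hz, one_pow] at hzn
      have hz01 : (s * z 0) ^ 2 + (s * z 1) ^ 2 ≤ S₀ ^ 2 := by
        have h1 : z 0 ^ 2 + z 1 ^ 2 ≤ 1 := by linarith only [hzn, sq_nonneg (z 2)]
        have h2 : s ^ 2 ≤ S₀ ^ 2 := pow_le_pow_left₀ hs0 hsS 2
        have e : (s * z 0) ^ 2 + (s * z 1) ^ 2 = s ^ 2 * (z 0 ^ 2 + z 1 ^ 2) := by ring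
        rw [e]
        calc s ^ 2 * (z 0 ^ 2 + z 1 ^ 2) ≤ s ^ 2 * 1 := mul_le_mul_of_nonneg_left h1 (sq_nonneg s)
          _ ≤ S₀ ^ 2 := by linarith only [h2]
      have hrn := norm_sq_eq_fin3 r
      have hry2 : ‖r‖ ^ 2 ≤ 20 ^ 2 := pow_le_pow_left₀ (norm_nonneg _) hry 2
      have hr01 : r 0 ^ 2 + r 1 ^ 2 ≤ 20 ^ 2 := by linarith only [hrn, hry2, sq_nonneg (r 2)]
      have := sq2_add_le hS₀0 (by norm_num : (0 : ℝ) ≤ 20) hz01 hr01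
      rw [ey 0, ey 1]; exact this
    have hx₀p : (x₀ 0 - p0) ^ 2 + (x₀ 1 - p1) ^ 2 ≤ 1 ^ 2 := hx₀h
    have h1 := sq2_add_le hρ0 (by norm_num : (0 : ℝ) ≤ 1) hp hx₀p
    have h2 := sq2_add_le (by linarith : (0 : ℝ) ≤ ρ - S₀ - 23 + 1) (by linarith : (0 : ℝ) ≤ S₀ + 20) h1 hdisp
    have e0 : y 0 = p0 + (x₀ 0 - p0) + (y 0 - x₀ 0) := by ring
    have e1 : y 1 = p1 + (x₀ 1 - p1) + (y 1 - x₀ 1) := by ring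
    rw [e0, e1]
    have e2 : ρ - S₀ - 23 + 1 + (S₀ + 20) = ρ - 2 := by ring
    rw [e2] at h2; exact h2
  -- run the refusal walk from `x₀` with axis through `x₀`
  have hstart_r : ‖x₀ - x₀ - ⟪x₀ - x₀, z⟫_ℝ • z‖ ^ 2 ≤ 289 := by simp
  have hstart_s : (0 : ℝ) ≤ ⟪x₀ - x₀, z⟫_ℝ := by simp
  obtain ⟨q, hq, hdeg, hrq, hq1, hq2⟩ := refusal_walk_pays hg hc X hX A₂ t₂ P₂ R₀ h ρ hR₀3 hρ hP₂X hcell hP₂ 𝓣 hT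
    𝓐 h𝓐 hm hmir hz hzm hσ hσz he₃ x₀ hlat
    ⌈((h + 2 * R₀ + 20 - x₀ 2) / σ - ⟪x₀ - x₀, z⟫_ℝ) * 32⌉₊ x₀ A₁ sa sb sc hx₀X hA₁ ha hb hc' hind
    (down ha ha') (down hb hb') (down hc' hc'') hstart_r hstart_s (by linarith) (Nat.le_ceil _)
  refine ⟨q, hq, hdeg, ?_, by linarith only [hq1, hx₀2'], hq2⟩
  -- lateral distance to the intended line through `qpt`
  have e1 : q - qpt - ⟪q - qpt, z⟫_ℝ • z = (q - x₀ - ⟪q - x₀, z⟫_ℝ • z) + ((x₀ - qpt) - ⟪x₀ - qpt, z⟫_ℝ • z) := by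
    have : q - qpt = (q - x₀) + (x₀ - qpt) := by abel
    rw [this, inner_add_left, add_smul]; abel
  rw [e1]
  have h2 : ‖(x₀ - qpt) - ⟪x₀ - qpt, z⟫_ℝ • z‖ ≤ 1 :=
    (norm_lateral_le _ z hz).trans (by rw [← dist_eq_norm, dist_comm]; exact hdx.le)
  exact (norm_add_le _ _).trans (by linarith only [hrq, h2])

open scoped Classical in
/-- **Injective tube count for refusal walks.**  See the module docstring. -/
theorem card_refusalPayers_ge {δ : ℝ} (hg : KissingGap δ) (hc : KissingClassification δ)
    (X : Finset (EuclideanSpace ℝ (Fin 3))) (hX : ∀ p ∈ X, ∀ q ∈ X, p ≠ q → 1 ≤ dist p q)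
    (A₁ : EuclideanSpace ℝ (Fin 3) ≃ₗᵢ[ℝ] EuclideanSpace ℝ (Fin 3)) (t₁ : EuclideanSpace ℝ (Fin 3))
    (A₂ : EuclideanSpace ℝ (Fin 3) ≃ₗᵢ[ℝ] EuclideanSpace ℝ (Fin 3)) (t₂ : EuclideanSpace ℝ (Fin 3))
    (P₁ P₂ : Finset (EuclideanSpace ℝ (Fin 3))) (R₀ h ρ : ℝ) (hR₀ : 10 ≤ R₀) (hρ : R₀ ≤ ρ)
    (hh : 0 ≤ h) (hP₁X : P₁ ⊆ X) (hP₂X : P₂ ⊆ X) (hcell : ∀ p ∈ X, p 2 ≤ h + 2 * R₀)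
    (hP₁ : ∀ p, p ∈ P₁ ↔ (p ∈ (fun q => A₁ q + t₁) '' fccStacking 1 (Real.sqrt (2 / 3)) ∧
      -(2 * R₀) ≤ p 2 ∧ p 2 ≤ -R₀ ∧ p 0 ^ 2 + p 1 ^ 2 ≤ ρ ^ 2))
    (hP₂ : ∀ p, p ∈ P₂ ↔ (p ∈ (fun q => A₂ q + t₂) '' fccStacking 1 (Real.sqrt (2 / 3)) ∧
      h + R₀ ≤ p 2 ∧ p 2 ≤ h + 2 * R₀ ∧ p 0 ^ 2 + p 1 ^ 2 ≤ ρ ^ 2))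
    (𝓣 : Set (EuclideanSpace ℝ (Fin 3) ≃ₗᵢ[ℝ] EuclideanSpace ℝ (Fin 3)))
    (hT : ∀ G : EuclideanSpace ℝ (Fin 3) ≃ₗᵢ[ℝ] EuclideanSpace ℝ (Fin 3),
      G '' fccStacking 1 (Real.sqrt (2 / 3)) = A₂ '' fccStacking 1 (Real.sqrt (2 / 3)) → G ∈ 𝓣)
    (𝓐 : Set (EuclideanSpace ℝ (Fin 3) ≃ₗᵢ[ℝ] EuclideanSpace ℝ (Fin 3))) (hA₁ : A₁ ∈ 𝓐) (h𝓐 : ∀ F ∈ 𝓐, F ∉ 𝓣)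
    {m : EuclideanSpace ℝ (Fin 3)} (hm : ‖m‖ = 1)
    (hmir : ∀ F ∈ 𝓐, ∀ n : EuclideanSpace ℝ (Fin 3), ‖n‖ = 1 →
      (∀ w ∈ fccSlots, ⟪F w, n⟫_ℝ = 0 ∨ ⟪F w, n⟫_ℝ = Real.sqrt (2 / 3) ∨ ⟪F w, n⟫_ℝ = -Real.sqrt (2 / 3)) →
      ∀ F' : EuclideanSpace ℝ (Fin 3) ≃ₗᵢ[ℝ] EuclideanSpace ℝ (Fin 3), (∀ x, F' x = F x - (2 * ⟪F x, n⟫_ℝ) • n) →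
        (F' ∉ 𝓣 → F' ∈ 𝓐) ∧ (F' ∈ 𝓣 → n = m ∨ n = -m))
    {z : EuclideanSpace ℝ (Fin 3)} (hz : ‖z‖ = 1) (hzm : ⟪z, m⟫_ℝ = 0)
    {σ : ℝ} (hσ : 0 < σ) (hσz : σ ≤ ⟪z, EuclideanSpace.single (2 : Fin 3) (1 : ℝ)⟫_ℝ)
    (he₃ : EuclideanSpace.single (2 : Fin 3) (1 : ℝ) =
      ⟪EuclideanSpace.single (2 : Fin 3) (1 : ℝ), z⟫_ℝ • z + ⟪EuclideanSpace.single (2 : Fin 3) (1 : ℝ), m⟫_ℝ • m)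
    (hρS : (h + 3 * R₀ + 21) / σ + 23 ≤ ρ)
    (M : ℕ) (hM : 2 * (43 / σ * (M : ℝ)) ^ 2 ≤ (ρ - (h + 3 * R₀ + 21) / σ - 23) ^ 2) :
    (2 * M + 1) ^ 2 ≤ (X.filter fun x => (X.filter fun q => dist x q = 1).card ≠ 12 ∧
      -R₀ - 22 ≤ x 2 ∧ x 2 ≤ h + R₀ + 4).card := by
  set e₃ : EuclideanSpace ℝ (Fin 3) := EuclideanSpace.single (2 : Fin 3) (1 : ℝ) with he₃def
  set L : ℝ := 43 / σ with hL
  set PAY := X.filter fun x => (X.filter fun q => dist x q = 1).card ≠ 12 ∧ -R₀ - 22 ≤ x 2 ∧ x 2 ≤ h + R₀ + 4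
    with hPAY
  set Gr : Finset (ℤ × ℤ) := Finset.Icc (-(M : ℤ)) M ×ˢ Finset.Icc (-(M : ℤ)) M with hGr
  have hGcard : Gr.card = (2 * M + 1) ^ 2 := by
    rw [hGr, Finset.card_product, Int.card_Icc]
    have : ((M : ℤ) + 1 - -(M : ℤ)).toNat = 2 * M + 1 := by omega
    rw [this]; ring
  have hLpos : 0 < L := by rw [hL]; positivity
  have hLσ : L * σ = 43 := by rw [hL]; field_simp
  set axis : ℤ × ℤ → EuclideanSpace ℝ (Fin 3) := fun ij =>
    EuclideanSpace.single (0 : Fin 3) (L * (ij.1 : ℝ)) + EuclideanSpace.single (1 : Fin 3) (L * (ij.2 : ℝ)) +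
      EuclideanSpace.single (2 : Fin 3) (-R₀) with haxis
  have haxis0 : ∀ ij, axis ij 0 = L * (ij.1 : ℝ) := fun ij => by simp [haxis]
  have haxis1 : ∀ ij, axis ij 1 = L * (ij.2 : ℝ) := fun ij => by simp [haxis]
  have haxis2 : ∀ ij, axis ij 2 = -R₀ := fun ij => by simp [haxis]
  -- every axis of the grid has a payer
  have key : ∀ ij ∈ Gr, ∃ q ∈ PAY, ‖q - axis ij - ⟪q - axis ij, z⟫_ℝ • z‖ ≤ 21 := by
    intro ij hij
    rw [hGr, Finset.mem_product, Finset.mem_Icc, Finset.mem_Icc] at hij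
    obtain ⟨⟨hi1, hi2⟩, ⟨hj1, hj2⟩⟩ := hij
    have hi : ((ij.1 : ℝ)) ^ 2 ≤ (M : ℝ) ^ 2 := by
      have h1 : (-(M : ℝ)) ≤ (ij.1 : ℝ) := by exact_mod_cast hi1
      have h2 : (ij.1 : ℝ) ≤ (M : ℝ) := by exact_mod_cast hi2
      nlinarith only [h1, h2]
    have hj : ((ij.2 : ℝ)) ^ 2 ≤ (M : ℝ) ^ 2 := by
      have h1 : (-(M : ℝ)) ≤ (ij.2 : ℝ) := by exact_mod_cast hj1
      have h2 : (ij.2 : ℝ) ≤ (M : ℝ) := by exact_mod_cast hj2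
      nlinarith only [h1, h2]
    have hp : (L * (ij.1 : ℝ)) ^ 2 + (L * (ij.2 : ℝ)) ^ 2 ≤ (ρ - (h + 3 * R₀ + 21) / σ - 23) ^ 2 := by
      have hL2 : 0 ≤ L ^ 2 := sq_nonneg L
      have e : (L * (ij.1 : ℝ)) ^ 2 + (L * (ij.2 : ℝ)) ^ 2 = L ^ 2 * ((ij.1 : ℝ) ^ 2 + (ij.2 : ℝ) ^ 2) := by ring
      have e2 : 2 * (43 / σ * (M : ℝ)) ^ 2 = L ^ 2 * (2 * (M : ℝ) ^ 2) := by rw [hL]; ring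
      rw [e]
      calc L ^ 2 * ((ij.1 : ℝ) ^ 2 + (ij.2 : ℝ) ^ 2) ≤ L ^ 2 * (2 * (M : ℝ) ^ 2) :=
            mul_le_mul_of_nonneg_left (by linarith only [hi, hj]) hL2
        _ ≤ _ := by rw [← e2]; exact hM
    obtain ⟨q, hq, hdeg, hrq, hq1, hq2⟩ := refusal_tube_pays hg hc X hX A₁ t₁ A₂ t₂ P₁ P₂ R₀ h ρ hR₀ hρ hh hP₁X hP₂X
      hcell hP₁ hP₂ 𝓣 hT 𝓐 hA₁ h𝓐 hm hmir hz hzm hσ hσz he₃ (L * (ij.1 : ℝ)) (L * (ij.2 : ℝ)) hp hρS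
    exact ⟨q, by rw [hPAY, mem_filter]; exact ⟨hq, hdeg, hq1, hq2.le⟩, hrq⟩
  choose! f hfP hfd using key
  -- payers of different axes differ
  have hinj : Set.InjOn f ↑Gr := by
    intro ij hij ij' hij' heq
    have h1 := hfd ij hij
    have h2 := hfd ij' hij'
    rw [heq] at h1
    by_contra hne
    -- lateral distance of the two intended lines is at most 42
    set v : EuclideanSpace ℝ (Fin 3) := axis ij' - axis ij with hv
    have hlat42 : ‖v - ⟪v, z⟫_ℝ • z‖ ≤ 42 := by
      have e : v - ⟪v, z⟫_ℝ • z = (f ij' - axis ij - ⟪f ij' - axis ij, z⟫_ℝ • z) -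
          (f ij' - axis ij' - ⟪f ij' - axis ij', z⟫_ℝ • z) := by
        rw [lateral_sub_lateral, hv]
        have : f ij' - axis ij - (f ij' - axis ij') = axis ij' - axis ij := by abel
        rw [this]
      rw [e]
      exact (norm_sub_le _ _).trans (by linarith)
    -- but it is at least `σ ‖v‖ ≥ 43`
    have hv2 : v 2 = 0 := by rw [hv, PiLp.sub_apply, haxis2, haxis2, sub_self]
    have hge := lateral_sq_ge_of_horizontal v z hz hv2
    have hvn : ‖v‖ ^ 2 = L ^ 2 * (((ij'.1 - ij.1 : ℤ) : ℝ) ^ 2 + ((ij'.2 - ij.2 : ℤ) : ℝ) ^ 2) := by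
      rw [norm_sq_eq_fin3 v, hv2]
      simp only [hv, PiLp.sub_apply, haxis0, haxis1]
      push_cast; ring
    have hint : (1 : ℤ) ≤ (ij'.1 - ij.1) ^ 2 + (ij'.2 - ij.2) ^ 2 := by
      have hne' : ij'.1 - ij.1 ≠ 0 ∨ ij'.2 - ij.2 ≠ 0 := by
        by_contra h0
        push Not at h0
        exact hne (Prod.ext (by omega) (by omega))
      rcases hne' with h0 | h0
      · have h1 : ij'.1 - ij.1 ≤ -1 ∨ 1 ≤ ij'.1 - ij.1 := by omega
        rcases h1 with h1 | h1 <;> nlinarith only [h1, sq_nonneg (ij'.2 - ij.2)]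
      · have h1 : ij'.2 - ij.2 ≤ -1 ∨ 1 ≤ ij'.2 - ij.2 := by omega
        rcases h1 with h1 | h1 <;> nlinarith only [h1, sq_nonneg (ij'.1 - ij.1)]
    have hint' : (1 : ℝ) ≤ ((ij'.1 - ij.1 : ℤ) : ℝ) ^ 2 + ((ij'.2 - ij.2 : ℤ) : ℝ) ^ 2 := by exact_mod_cast hint
    have hvL : L ^ 2 ≤ ‖v‖ ^ 2 := by
      rw [hvn]
      calc L ^ 2 = L ^ 2 * 1 := (mul_one _).symm
        _ ≤ _ := mul_le_mul_of_nonneg_left hint' (sq_nonneg L)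
    have hσ2 : σ ^ 2 ≤ ⟪z, e₃⟫_ℝ ^ 2 := pow_le_pow_left₀ hσ.le hσz 2
    have h43 : (43 : ℝ) ^ 2 ≤ ‖v - ⟪v, z⟫_ℝ • z‖ ^ 2 := by
      have h1' : σ ^ 2 * L ^ 2 = 43 ^ 2 := by rw [show σ ^ 2 * L ^ 2 = (L * σ) ^ 2 by ring, hLσ]
      calc (43 : ℝ) ^ 2 = σ ^ 2 * L ^ 2 := h1'.symm
        _ ≤ σ ^ 2 * ‖v‖ ^ 2 := mul_le_mul_of_nonneg_left hvL (sq_nonneg σ)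
        _ ≤ ⟪z, e₃⟫_ℝ ^ 2 * ‖v‖ ^ 2 := mul_le_mul_of_nonneg_right hσ2 (sq_nonneg _)
        _ ≤ _ := hge
    have h42 : ‖v - ⟪v, z⟫_ℝ • z‖ ^ 2 ≤ 42 ^ 2 := pow_le_pow_left₀ (norm_nonneg _) hlat42 2
    linarith only [h43, h42]
  rw [← hGcard]
  exact Finset.card_le_card_of_injOn f (fun ij hij => hfP ij hij) hinj

end Summit.Ventures.Crystal3D.Theorems

end
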